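import Summits.QuantumFields.YangMills.Theorems.UnitScaleTiltFluctuationComparisonRegPrIntLOneSupplierDisplay
import Summits.QuantumFields.YangMills.Theorems.UnitScaleTiltMinimiserStabilityRegPrAttainmentOfExistence
import HarnessLib

/-!
# `UnitScaleTiltFluctuationComparisonRegPrIntLOfHalvingInterior` — THE DECIDING CRUX `FluctuationComparisonRegPrIntL` (stmt-QuantumFields-20520, skeleton v5kC) BY NAME
# UNDER ROUTE (β) OF 19200's v10: `stub_halvingStep` ∧ the ONE interiority sentence of the closed-fibre direct method (`UnitScaleTiltProp7ClosedFibreMinimiser` §4, supplying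
# `stub_existenceMinimalOrbit`) ∧ the χ-record 2′χ ∧ ym-ust-20520-w1's per-run display obligation — ★r1 g3/g5's one-supplier engine with T8 from
# `AttainmentOfExistence.thm1In8GlobalMin_of_halvingStep_of_interior` (the {H, EX} twins are ym-ust-20520-w3 g2's `…IntLT8OfHalvingExist`, p592464, not restated)

Cell `ym3-torus` (HUMAN RULING D-0037, YM ladder rung R3), width seat `ym-ust-20520-w4` (g0); LOCATED FINDING w4-1 («v9's rows `stub_PV3A`, `stub_PV3Cuniq` are idle», memo
`FINDING-w4-1-uniqueness-idle.md`, evidence on 19200/20520).  THEOREMS ONLY (0 `def`, 0 `sorry`, standard axioms); CONDITIONAL compositions concluding the route decl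
`Summit.QuantumFields.YangMills.Theses.UnitScaleTilt.FluctuationComparisonRegPrIntL` BY NAME from named hypotheses; `--supports stmt-QuantumFields-20520 --as helper`.

BY NAME: `FluctuationComparisonRegPrIntL` ⇐ STUB 1 (closed: `ApproxLift.AnsatzT.stub_oneStepSmallLift`) ∧ T8 ∧ 2′χ ∧ K1a (`InteriorExcision.regPrIntL_of_v3ChiStubs`, ★r1 g3/g4), and
T8 ⇐ ⟨`stub_halvingStep`⟩ ∧ INTERIOR (`AttainmentOfExistence.thm1In8GlobalMin_of_halvingStep_of_interior`).  Hence
`regPrIntL_of_halvingStep_interior_recChi_k1aLegRowsDisplayChi_allL`: the DECIDING crux ⇐ {H = Sect. F halving, INTERIOR = «closed-fibre minimisers over (7)-data with a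
(14)-background are interior» (OWNER RULING g24-№5 route (β); the a-priori estimate is ym-ust-19200-w4's), 2′χ = the χ-record, w1's display rows `K1aLegRowsDisplayChi`} —
chart rows by `k1aChartRowsKChi_of_displayChi` (★r1 g5).

HONEST FRAMING.  Compositions by name; nothing of [Balaban1985UV3]/[King1986]/[Balaban1985Variational] is asserted; every hypothesis stays open as before; the crux, the stubs
and R3 stay OPEN; no count moves; YM₃ on T³ is ladder rung R3 — not d = 4, not infinite volume, not a mass gap, not the Clay problem.

References: T. Bałaban, CMP **102** (1985) 255–275 [Balaban1985UV3] ((41) p.266, (43)–(47) pp.266–267, Thm 2 p.272); CMP **102** (1985) 277–309 [Balaban1985Variational]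
(Thm 1 (8) p.279, Prop. 7 p.299, Prop. 8 p.304); C. King, CMP **102** (1986) 649–677 [King1986] (Thm 3.4 (3.9) p.656, Prop. 3.6 (3.56) p.662).
-/

set_option autoImplicit false

noncomputable section

namespace Summit.QuantumFields.YangMills.Theorems.InteriorExcision

open scoped Matrix.Norms.L2Operator
open Literature.MathematicalPhysics.QuantumFieldTheory.Balaban1983to89
open Literature.MathematicalPhysics.QuantumFieldTheory.Balaban1983to89.T3ContinuumYM3Torus
open Literature.MathematicalPhysics.QuantumFieldTheory.Balaban1983to89.T3UnitLawDensityEML (ℰp)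
open Literature.MathematicalPhysics.QuantumFieldTheory.Balaban1983to89.T3InteriorExcision
open Literature.MathematicalPhysics.QuantumFieldTheory.Balaban1983to89.T3PrintedRegularMinimiser
open Literature.MathematicalPhysics.QuantumFieldTheory.Balaban1983to89.T3PrintedMinimiserExistence
open Literature.MathematicalPhysics.QuantumFieldTheory.Balaban1983to89.T3RegularMinimiser (regThreshold)
open Literature.MathematicalPhysics.QuantumFieldTheory.Balaban1983to89.T3ConstrainedMinimiser (fibre)
open Literature.MathematicalPhysics.QuantumFieldTheory.Balaban1983to89.T3TiltDescent (descendTo)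
open Literature.MathematicalPhysics.QuantumFieldTheory.Balaban1983to89.T3Thm1Carrier (famX Idx)
open Literature.MathematicalPhysics.QuantumFieldTheory.Balaban1983to89.B10Eq27TorusAxialLog (toUField unitsField)
open Literature.MathematicalPhysics.QuantumFieldTheory.Balaban1983to89.B10Eq68TorusRegularity (covDivT)
open Summit.QuantumFields.Balaban3D.Carriers
open Summit.QuantumFields.Balaban3D.Proofs.Primitives
open Summit.QuantumFields.YangMills.Theorems.GlobalSlackCanonicalPolymers (K1aChartRowsKChi globalTwoRunSlackFamChi_of_k1aChartRowsKChi)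
open Summit.QuantumFields.YangMills.Theorems.GlobalSlackCanonicalOnChi (smallBlocksSlackOnChiAllChi_of_k1aChartRowsKChi_all)
open Summit.QuantumFields.YangMills.Theorems.GlobalSlackKernelLeg (K1aLegRowsDisplayChi)
open Summit.QuantumFields.YangMills.Theorems.AttainmentOfExistence (thm1In8GlobalMin_of_halvingStep_of_interior)

/-- **ROUTE (β) TWIN — THE DECIDING CRUX FROM `stub_halvingStep`, THE ONE INTERIORITY SENTENCE OF THE CLOSED-FIBRE DIRECT METHOD, THE χ-RECORD AND THE PER-RUN DISPLAY
OBLIGATION**: T8 by `AttainmentOfExistence.thm1In8GlobalMin_of_halvingStep_of_interior` (`UnitScaleTiltProp7ClosedFibreMinimiser.existenceMinimalOrbit_of_interior_allL` ∘ §4 of the sibling).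
[cite: Balaban1985UV3, (41) p.266, (43)-(47) pp.266-267, Thm 2 p.272; Balaban1985Variational, Thm 1 (8) p.279, (2)-(6) p.278, Prop. 7 p.299, Prop. 8 p.304; King1986, Prop. 3.6 (3.56) p.662] -/
theorem regPrIntL_of_halvingStep_interior_recChi_k1aLegRowsDisplayChi_allL
    (hV2 : ∀ (L : ℕ), 1 < L → ∃ B₃ : ℝ, 4 < B₃ ∧ ∃ a₅ : ℝ, 0 < a₅ ∧
      ∀ (i : Idx L) (ε₀ ε₁ : ℝ), 0 < ε₁ → ∀ (V : (famX L i).Bdry) (U : (famX L i).Cfg), (famX L i).Reg7 ε₁ V → (famX L i).InU ε₀ U →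
        (famX L i).InB V U → (famX L i).IsCritical V U → ε₀ ≤ a₅ → (famX L i).InU (max (B₃ * ε₁) (ε₀ / 2)) U)
    (hInt : ∀ L : ℕ, 1 < L → ∀ B₃ : ℝ, 4 < B₃ → ∃ a₁' O₁ : ℝ, 0 < a₁' ∧ 1 ≤ O₁ ∧
      ∀ F : T3Family, F.L = L → ∀ (n K : ℕ) (hnK : n < K) (ε₁ : ℝ), 0 < ε₁ → ε₁ ≤ a₁' →
        ∀ V : GaugeField (F.P n) 0 (Matrix.specialUnitaryGroup (Fin 2) ℂ), PlaqSmall ε₁ V →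
          ∀ U₀ : GaugeField (F.P K) 0 (Matrix.specialUnitaryGroup (Fin 2) ℂ), RegPr F n K ((L : ℝ) ^ 3 * B₃ * ε₁) U₀ →
            U₀ ∈ fibre F ℰp n K hnK.le V →
            ∀ Ū : GaugeField (F.P K) 0 (Matrix.specialUnitaryGroup (Fin 2) ℂ),
              Ū ∈ {U : GaugeField (F.P K) 0 (Matrix.specialUnitaryGroup (Fin 2) ℂ) | ∀ p : Plaq (F.P K) 0,
                    GaugeGroup.dist1 (GaugeField.plaqHol U p) ≤ regThreshold F n K (O₁ * (L : ℝ) ^ 3 * B₃ * ε₁)} ∩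
                  descendTo F ℰp n K hnK.le ⁻¹' {V} ∩
                  {U | ∀ b : PBond (F.P K) 0, ‖covDivT 1 (unitsField (toUField U)) b.dir b.src‖ ≤
                    (O₁ * (L : ℝ) ^ 3 * B₃ * ε₁) * ((F.L : ℝ)⁻¹) ^ (3 * (K - n))} →
              IsMinOn (fun W : GaugeField (F.P K) 0 (Matrix.specialUnitaryGroup (Fin 2) ℂ) => wilsonAction4 W)
                ({U : GaugeField (F.P K) 0 (Matrix.specialUnitaryGroup (Fin 2) ℂ) | ∀ p : Plaq (F.P K) 0,
                    GaugeGroup.dist1 (GaugeField.plaqHol U p) ≤ regThreshold F n K (O₁ * (L : ℝ) ^ 3 * B₃ * ε₁)} ∩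
                  descendTo F ℰp n K hnK.le ⁻¹' {V} ∩
                  {U | ∀ b : PBond (F.P K) 0, ‖covDivT 1 (unitsField (toUField U)) b.dir b.src‖ ≤
                    (O₁ * (L : ℝ) ^ 3 * B₃ * ε₁) * ((F.L : ℝ)⁻¹) ^ (3 * (K - n))}) Ū →
              RegPr F n K (O₁ * (L : ℝ) ^ 3 * B₃ * ε₁) Ū)
    (h2 : ∀ L : ℕ, Odd L → 1 < L → Summit.QuantumFields.YangMills.Theorems.AlphaInputsT3ACv3RecChi L)
    (hDisp : ∀ (L : ℕ), Odd L → 1 < L → ∀ (𝔠 : AlphaConsts L (suGroupModel 2).N) (a₀ a₁ : ℝ), 0 < a₀ → 0 < a₁ → 𝔠.B₃ * a₁ ≤ a₀ →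
      ∃ a : ℝ, 0 < a ∧ a < 1 ∧ K1aLegRowsDisplayChi L 𝔠 a₀ a₁ a) :
    FluctuationComparisonRegPrIntL :=
  regPrIntL_of_v3ChiStubs Summit.QuantumFields.YangMills.Theorems.ApproxLift.AnsatzT.stub_oneStepSmallLift
    (thm1In8GlobalMin_of_halvingStep_of_interior hV2 hInt) h2
    (globalTwoRunSlackFamChi_of_k1aChartRowsKChi fun L hLo h7 𝔠 a₀ a₁ ha0 ha1 hw => by
      obtain ⟨a, ha, ha1', hc⟩ := hDisp L hLo (by omega) 𝔠 a₀ a₁ ha0 ha1 hw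
      exact ⟨a, ha, ha1', k1aChartRowsKChi_of_displayChi ha hc⟩)
    (smallBlocksSlackOnChiAllChi_of_k1aChartRowsKChi_all fun L hLo hL1 _ 𝔠 a₀ a₁ ha0 ha1 hw => by
      obtain ⟨a, ha, ha1', hc⟩ := hDisp L hLo hL1 𝔠 a₀ a₁ ha0 ha1 hw
      exact ⟨a, ha, ha1', k1aChartRowsKChi_of_displayChi ha hc⟩)

end Summit.QuantumFields.YangMills.Theorems.InteriorExcision

end
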